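import Mathlib
import Summits.ValiantsHypothesis.ValiantsHypothesis.Theorems.BorderApolarityToricWitnessObstructionQPStubTorusBound

/-!
# Crux `RigidityForcesSymmetry.RigidMinimalRepr` (stmt-ValiantsHypothesis-4163), line `registered` —
# stub `stub_levelCard` (the graded pigeonhole, cardinality form)

Route `ValiantsHypothesis/RigidityForcesSymmetry`, crux `RigidMinimalRepr`, skeleton
`Cruxes/RigidMinimalRepr/Lines/registered.lean` (lead's refutation skeleton), worker stub `stub_levelCard`.

**Statement.** Let `B` be an endomorphism of a finite-dimensional complex vector space `V` and `wt (I, J)`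
an injective family of scalars indexed by pairs of subsets of `[m]`.  Call a pair `(I, J)` *present* if the
generalised eigenspace of `B` at `wt (I, J)` is non-zero.  If for every `σ ∈ 𝔖_m` and every `1 ≤ s ≤ m`
some pair `(I, σ(I))` with `|I| = s` is present, then (a) the present pairs with `|I| ≥ 1` number at least
`2 ^ m - 1`, and (b) all present pairs number at most `dim V`.

**Proof.** This is the tree's `BorderApolarityToricWitnessObstructionQP.torusBound_levelCount` with the set
of present pairs kept in the statement.  (b): distinct pairs have distinct weights, so the non-zero
generalised eigenspaces of the present pairs are independent (`Module.End.independent_maxGenEigenspace`),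
whence their number is at most `finrank` (`iSupIndep.subtype_ne_bot_le_finrank`).  (a): a pair `(I, J)`
serves only the `s! (m - s)!` permutations `σ` with `σ(I) = J` (`torusBound_card_perm_map_le`), so by the
pigeonhole over `𝔖_m` level `s` (`1 ≤ s ≤ m`) carries at least `m! / (s! (m - s)!) = C(m, s)` present pairs,
all with `|I| = s ≥ 1`; summing over the levels, `Σ_{s = 1}^{m} C(m, s) = 2 ^ m - 1`.
-/

set_option autoImplicit false

-- the mandated summit-side namespace repeats a component by design (single-problem summit)
set_option linter.dupNamespace false

noncomputable section

open Finset Module.End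
open Summit.ValiantsHypothesis.ValiantsHypothesis.Theorems.BorderApolarityToricWitnessObstructionQP
  (torusBound_card_perm_map_le)

namespace Summit.ValiantsHypothesis.ValiantsHypothesis.Theorems.RigidityForcesSymmetryRigidMinimalRepr

/-- **Present pairs have independent non-zero eigenspaces.**  For an injective family of weights
`wt (I, J)`, the pairs whose generalised eigenspace is non-zero number at most `dim V`
(`Module.End.independent_maxGenEigenspace` and `iSupIndep.subtype_ne_bot_le_finrank`). [folklore] -/
theorem levelCard_present_le_finrank {V : Type*} [AddCommGroup V] [Module ℂ V] [FiniteDimensional ℂ V]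
    (B : Module.End ℂ V) {m : ℕ} (wt : Finset (Fin m) → Finset (Fin m) → ℂ)
    (hwt : ∀ I J I' J', wt I J = wt I' J' → I = I' ∧ J = J')
    (W : Finset (Finset (Fin m) × Finset (Fin m)))
    (hW : ∀ IJ ∈ W, B.maxGenEigenspace (wt IJ.1 IJ.2) ≠ ⊥) :
    W.card ≤ Module.finrank ℂ V := by
  classical
  let g : ↥W → ℂ := fun IJ => wt IJ.1.1 IJ.1.2
  have hg : Function.Injective g := by
    rintro ⟨⟨I, J⟩, hIJ⟩ ⟨⟨I', J'⟩, hIJ'⟩ h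
    obtain ⟨rfl, rfl⟩ := hwt I J I' J' h
    rfl
  have hind : iSupIndep (fun IJ : ↥W => B.maxGenEigenspace (g IJ)) :=
    B.independent_maxGenEigenspace.comp hg
  have hne : ∀ IJ : ↥W, (fun IJ : ↥W => B.maxGenEigenspace (g IJ)) IJ ≠ ⊥ := fun IJ => hW IJ.1 IJ.2
  have := hind.subtype_ne_bot_le_finrank
  rwa [Fintype.card_congr (Equiv.subtypeUnivEquiv hne), Fintype.card_coe] at this

/-- **The graded pigeonhole, one level.**  If every `σ ∈ 𝔖_m` is served at level `s` (`1 ≤ s ≤ m`) by a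
pair `(I, σ(I))`, `|I| = s`, lying in a set `T` of pairs, then `C(m, s) ≤ |T|`: a pair `(I, J)` serves only
the `s! (m - s)!` permutations with `σ(I) = J` (`torusBound_card_perm_map_le`). [folklore] -/
theorem levelCard_choose_le {m : ℕ} (T : Finset (Finset (Fin m) × Finset (Fin m))) (s : ℕ)
    (hsm : s ≤ m) (hT : ∀ IJ ∈ T, IJ.1.card = s)
    (hserved : ∀ σ : Equiv.Perm (Fin m), ∃ I : Finset (Fin m), (I, I.map σ.toEmbedding) ∈ T) :
    m.choose s ≤ T.card := by
  classical
  choose I hI using hserved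
  let f : Equiv.Perm (Fin m) → Finset (Fin m) × Finset (Fin m) := fun σ => (I σ, (I σ).map σ.toEmbedding)
  have hf : ∀ σ ∈ (univ : Finset (Equiv.Perm (Fin m))), f σ ∈ T := fun σ _ => hI σ
  have hfib : ∀ b ∈ T, (univ.filter fun σ => f σ = b).card ≤ s.factorial * (m - s).factorial := by
    rintro ⟨I₀, J₀⟩ hb
    have hI₀ : I₀.card = s := hT _ hb
    calc (univ.filter fun σ => f σ = (I₀, J₀)).card
        ≤ (univ.filter fun σ : Equiv.Perm (Fin m) => I₀.map σ.toEmbedding = J₀).card := by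
          refine card_le_card fun σ hσ => ?_
          simp only [mem_filter, mem_univ, true_and, f, Prod.mk.injEq] at hσ ⊢
          rw [← hσ.1]
          exact hσ.2
      _ ≤ s.factorial * (m - s).factorial := by
          rw [← hI₀]; exact torusBound_card_perm_map_le I₀ J₀
  have hcount := card_le_mul_card_image_of_maps_to hf _ hfib
  rw [card_univ, Fintype.card_perm, Fintype.card_fin] at hcount
  refine Nat.le_of_mul_le_mul_right ?_ (Nat.mul_pos (Nat.factorial_pos s) (Nat.factorial_pos (m - s)))
  calc m.choose s * (s.factorial * (m - s).factorial) = m.factorial := by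
        rw [← mul_assoc, Nat.choose_mul_factorial_mul_factorial hsm]
    _ ≤ s.factorial * (m - s).factorial * T.card := hcount
    _ = T.card * (s.factorial * (m - s).factorial) := mul_comm _ _

/-- **Level count, cardinality form** (the graded pigeonhole of `torusBound_levelCount`, keeping the set
of present pairs): levels `s ≥ 1` carry at least `2^m - 1` present pairs, and all present pairs have
independent non-zero generalised eigenspaces, so there are at most `dim V` of them.
[cite: LandsbergRessayre2017, §6] -/
theorem stub_levelCard {V : Type*} [AddCommGroup V] [Module ℂ V] [FiniteDimensional ℂ V]
    (B : Module.End ℂ V) {m : ℕ} (wt : Finset (Fin m) → Finset (Fin m) → ℂ)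
    (hwt : ∀ I J I' J', wt I J = wt I' J' → I = I' ∧ J = J')
    (hserved : ∀ σ : Equiv.Perm (Fin m), ∀ s, 1 ≤ s → s ≤ m →
      ∃ I : Finset (Fin m), I.card = s ∧ B.maxGenEigenspace (wt I (I.map σ.toEmbedding)) ≠ ⊥) :
    2 ^ m - 1 ≤ ((Finset.univ : Finset (Finset (Fin m) × Finset (Fin m))).filter fun IJ =>
        1 ≤ IJ.1.card ∧ B.maxGenEigenspace (wt IJ.1 IJ.2) ≠ ⊥).card ∧
    ((Finset.univ : Finset (Finset (Fin m) × Finset (Fin m))).filter fun IJ =>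
        B.maxGenEigenspace (wt IJ.1 IJ.2) ≠ ⊥).card ≤ Module.finrank ℂ V := by
  classical
  refine ⟨?_, levelCard_present_le_finrank B wt hwt _ fun IJ hIJ => (mem_filter.1 hIJ).2⟩
  -- the present pairs of positive level
  set W : Finset (Finset (Fin m) × Finset (Fin m)) :=
    univ.filter fun IJ => 1 ≤ IJ.1.card ∧ B.maxGenEigenspace (wt IJ.1 IJ.2) ≠ ⊥ with hW
  -- (1) level `s ≥ 1` carries at least `C(m, s)` pairs of `W`
  have h2 : ∀ s, 1 ≤ s → s ≤ m → m.choose s ≤ (W.filter fun IJ => IJ.1.card = s).card := by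
    intro s hs1 hsm
    refine levelCard_choose_le _ s hsm (fun IJ hIJ => (mem_filter.1 hIJ).2) fun σ => ?_
    obtain ⟨I, hI, hE⟩ := hserved σ s hs1 hsm
    refine ⟨I, ?_⟩
    simp only [hW, mem_filter, mem_univ, true_and]
    exact ⟨⟨hs1.trans_eq hI.symm, hE⟩, hI⟩
  -- (2) level `0` of `W` is empty
  have h0 : (W.filter fun IJ => IJ.1.card = 0).card = 0 := by
    rw [card_eq_zero, filter_eq_empty_iff]
    intro IJ hIJ h
    have := (mem_filter.1 hIJ).2.1
    omega
  -- (3) sum over the levels `s = 0, …, m`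
  have h3 : W.card = ∑ s ∈ range (m + 1), (W.filter fun IJ => IJ.1.card = s).card :=
    card_eq_sum_card_fiberwise (f := fun IJ : Finset (Fin m) × Finset (Fin m) => IJ.1.card)
      fun IJ _ => mem_range_succ_iff.2 (card_finset_fin_le IJ.1)
  have h4 : 2 ^ m ≤ W.card + 1 := by
    rw [← Nat.sum_range_choose m, h3]
    have : ∑ s ∈ range (m + 1), (W.filter fun IJ => IJ.1.card = s).card + 1 =
        ∑ s ∈ range (m + 1), ((W.filter fun IJ => IJ.1.card = s).card + if s = 0 then 1 else 0) := by
      rw [sum_add_distrib, sum_ite_eq']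
      simp
    rw [this]
    refine sum_le_sum fun s hs => ?_
    rcases Nat.eq_zero_or_pos s with rfl | hs1
    · rw [h0]; simp
    · rw [if_neg (by omega), add_zero]
      exact h2 s hs1 (by rw [mem_range] at hs; omega)
  omega

end Summit.ValiantsHypothesis.ValiantsHypothesis.Theorems.RigidityForcesSymmetryRigidMinimalRepr

end
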